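import Mathlib
import Literature.MathematicalPhysics.StatisticalMechanics.Crystallization
import Summits.AtomisticToContinuum.Crystallization.Theses.ThreeConeCertificate
import Summits.AtomisticToContinuum.Crystallization.Theorems.ThreeConeCertificateExactCertificateFarEqual

/-!
# Crux `ExactCertificate` (stmt-AtomisticToContinuum-11959), line `closure-makes-nogap-exact`, lead c10:
# skeleton IX — THE SLACK CONE IS ACTIVE BEYOND EVERY RADIUS (`FarSlackActive`): the census's S⁺₂ refuted

Skeleton IX v2 (c10, 2026-08-17 17:30Z) — SORRY-FREE: all nine registered stubs LANDED (F0 p166304, F1 p166432, F2 p166517, F3 p166466,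
F4 p166580, F5 p166789, F6 p166674, F7 `stub_sliceMaxPow` p167505, assembly `stub_farEqualAssembly` p167934) and are imported; the deciding
statement is closed below by the landed assembly.  v1 (15:15Z): composition proved modulo stubs.

The 3-D line is parked (crux = `NoGap ∧ KeplerBound`, `KeplerBound` = item 11961 ↔ 0627 open).  Skeleton VIII proved that the
OPERATOR of the d = 1 mechanism (a finite-range invisible radial kernel) does not exist in d ≥ 2.  Skeleton IX refutes the FORM of
the d = 1 certificate in d = 3: in d = 1 the exact certificate has `U ≡ 0` and `f = V` beyond the first shell (Transfer I, V); STRATEGY-CENSUS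
§3 S⁺₂ asserts that an exact 3-D certificate with `U ≡ 0` beyond some radius is impossible ("`f̂ = (c₁₂/12)k⁹ − (c₆/6)k³ + entire`,
`O(K)` zeros vs `≍K²` Bragg radii") — a memo so far.  Deciding statement:

  `FarSlackActive` := for every exact three-cone certificate `(P, ρ, c, g, U, f)` of the crux (the six clauses VERBATIM) whose
  Bochner kernel `f` is measurable and whose template `P` has a commensurate motif (`q(x − x′) ∈ G`; Bravais, hcp, fcc, …), the slack
  cone is active beyond every radius: `∀ ρ′, ∃ r ≥ ρ′, U r ≠ 0`.

Proof.  If `U ≡ 0` on `[ρ′, ∞)` then `f = V_LJ` on `[ρ″, ∞)`, `ρ″ = max ρ ρ′ 1`.  `F = f∘‖·‖` is integrable (`|f| ≤ f 0`, `V = O(r⁻⁶)`),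
so Bragg-peak vanishing (`…StrictCertificateBragg.structureFactor_mul_fourier_eq_zero`) and the commensurate structure factor give
`𝓕F = 0` on a dilated dual plane minus `0`.  Split `F = H + G`, `G = V_LJ(max(‖·‖, ρ″))` (explicit, radial, `= F` beyond `ρ″`), `H` of
compact support.  The slice `s ↦ 𝓕H(s e₀)` is entire of exponential type (skeleton VIII, `stub_sliceEntire`); the NEW analytic input is
that `s ↦ 𝓕G(s e₀)` restricted to `s > 0` ALSO extends to an entire function of exponential type (`stub_sliceMaxPow`): slicing
`ℝ³ = ℝ × ℝ²` (`stub_sliceBridge`) turns it into the 1-D transform of the plank profile `P(x) = ∫_{ℝ²} G`, which is explicit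
(`stub_planeIntegralMaxPow`: `c·max(|x|,ρ″)^{2−2m} +` compact), and the cosine transform of the power tail `∫_ρ^∞ x^{−N}cos(σx)dx`
equals, for `σ > 0`, polynomial `+ C|σ|^{N−1} −` (entire remainder) by subtracting the Taylor polynomial of `cos` and SCALING the
absolutely convergent remainder integral (`stub_cosTaylorBounds`, `stub_remEntire`, `stub_remScaling`, `stub_tailCosTransform`) — no
Dirichlet integral, no contour shift.  So `Ξ = Φ_H + Θ_G` is entire of exponential type and vanishes at the norms of the dual plane:
`Ξ ≡ 0` by the ENGINE of skeleton VIII, hence `𝓕F(ξ) = 0` for `ξ ≠ 0`, hence everywhere (continuity), hence `F = 0` at every continuity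
point (Fourier inversion) — but `F = V_LJ(ρ″ + 1) < 0` near `(ρ″+1)e₀`.  Contradiction.
-/

noncomputable section

namespace Summit.AtomisticToContinuum.Crystallization.Cruxes.ExactCertificate.FarEqual

open Literature.MathematicalPhysics.StatisticalMechanics MeasureTheory Set Filter Topology
open Summit.AtomisticToContinuum.Crystallization.Theorems.ChargedEnergyGapNegative (E3)
open Summit.AtomisticToContinuum.Crystallization.Theorems.ThreeConeCertificateExactCertificate.FarEqual
open scoped BigOperators FourierTransform RealInnerProductSpace

/-! ## The stubs: ALL LANDED (imported; namespace `…Theorems.ThreeConeCertificateExactCertificate.FarEqual`):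
`stub_fourierEntireReal` (F0, p166304), `stub_sliceBridge` (F1, p166432), `stub_planeIntegralMaxPow` (F2, p166517), `stub_cosTaylorBounds`
(F3, p166466), `stub_remEntire` (F4, p166580), `stub_remScaling` (F5, p166789), `stub_tailCosTransform` (F6, p166674), `stub_sliceMaxPow`
(F7, lead, p167505), `stub_farEqualAssembly` (assembly, lead, p167934). -/

/-- **The deciding statement of skeleton IX: THE SLACK CONE IS ACTIVE BEYOND EVERY RADIUS.**  For every exact three-cone certificate
`(P, ρ, c, g, U, f)` (the six clauses of the crux verbatim) with measurable Bochner kernel `f` and a commensurate motif, and every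
radius `ρ′`, there is `r ≥ ρ′` with `U r ≠ 0`.  Equivalently (census S⁺₂): no exact certificate at such a template has `U ≡ 0` beyond a
finite radius — the d = 1 form of the certificate (Transfer I, V: `U ≡ 0`, `f = V` beyond the first shell) does not exist in d = 3. -/
def FarSlackActive : Prop :=
  ∀ (P : PeriodicConfiguration 3) (ρ c : ℝ) (g U f : ℝ → ℝ),
    (∀ r : ℝ, 0 < r → lennardJones r = g r + U r + f r) → (∀ r : ℝ, 0 < r → 0 ≤ U r) →
    (∀ r : ℝ, ρ ≤ r → g r = 0) →
    (∀ (n : ℕ) (y : Fin n → EuclideanSpace ℝ (Fin 3)) (w : Fin n → ℝ),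
      0 ≤ ∑ i, ∑ j, w i * w j * f (dist (y i) (y j))) →
    (∀ (N : ℕ) (x : Fin N → EuclideanSpace ℝ (Fin 3)), Function.Injective x →
      -(c * (N : ℝ)) ≤ interactionEnergy g x) →
    c + f 0 / 2 = -(P.energyPerParticle lennardJones) →
    Measurable f →
    (∃ q : ℕ, 0 < q ∧ ∀ x ∈ P.motif, ∀ x' ∈ P.motif, (q : ℝ) • (x - x') ∈ P.lattice) →
    ∀ ρ' : ℝ, ∃ r : ℝ, ρ' ≤ r ∧ U r ≠ 0

/-- `V_LJ(r) < 0` for `r > 1`. -/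
theorem lennardJones_neg_of_one_lt {r : ℝ} (hr : 1 < r) : lennardJones r < 0 := by
  have hr0 : 0 < r := by linarith
  have hu0 : 0 < r⁻¹ := inv_pos.2 hr0
  have hu1 : r⁻¹ < 1 := inv_lt_one_of_one_lt₀ hr
  have h : (r⁻¹) ^ 12 < (r⁻¹) ^ 6 := pow_lt_pow_right_of_lt_one₀ hu0 hu1 (by norm_num)
  unfold lennardJones
  nlinarith [pow_pos hu0 6]

/-- `|V_LJ(r)| (1 + r)⁶ ≤ 16` for `r ≥ 1`. -/
theorem abs_lennardJones_mul_le {r : ℝ} (hr : 1 ≤ r) : |lennardJones r| * (1 + r) ^ 6 ≤ 16 := by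
  have hr0 : 0 < r := by linarith
  set u : ℝ := r⁻¹ with hu
  have hu0 : 0 < u := inv_pos.2 hr0
  have hu1 : u ≤ 1 := inv_le_one_of_one_le₀ hr
  have h1 : |lennardJones r| ≤ u ^ 6 / 4 := by
    unfold lennardJones
    rw [← hu]
    have h12 : u ^ 12 ≤ u ^ 6 := pow_le_pow_of_le_one hu0.le hu1 (by norm_num)
    rw [abs_le]
    constructor <;> nlinarith [pow_pos hu0 12, pow_pos hu0 6]
  have h2 : (1 + r) * u ≤ 2 := by
    rw [hu, add_mul, mul_inv_cancel₀ hr0.ne', one_mul]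
    linarith [hu1]
  have h3 : ((1 + r) * u) ^ 6 ≤ 2 ^ 6 := pow_le_pow_left₀ (by positivity) h2 6
  calc |lennardJones r| * (1 + r) ^ 6 ≤ u ^ 6 / 4 * (1 + r) ^ 6 := by gcongr
    _ = ((1 + r) * u) ^ 6 / 4 := by ring
    _ ≤ 2 ^ 6 / 4 := by gcongr
    _ = 16 := by norm_num

/-- The capped power `max(‖v‖², ρ²)^{−m}` (`ρ ≥ 1`, `m ≥ 3`) is continuous, bounded by `64 (1 + ‖v‖)^{−6}`, hence integrable
on `ℝ³`. -/
theorem integrable_maxPow {ρ : ℝ} (hρ : 1 ≤ ρ) {m : ℕ} (hm : 3 ≤ m) :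
    Integrable (fun v : E3 => ((((max (‖v‖ ^ 2) (ρ ^ 2))⁻¹) ^ m : ℝ) : ℂ)) := by
  have hpos : ∀ v : E3, 0 < max (‖v‖ ^ 2) (ρ ^ 2) := fun v =>
    lt_of_lt_of_le (by positivity) (le_max_right _ _)
  have hcont : Continuous fun v : E3 => ((((max (‖v‖ ^ 2) (ρ ^ 2))⁻¹) ^ m : ℝ) : ℂ) := by
    refine Complex.continuous_ofReal.comp ?_
    refine Continuous.pow (Continuous.inv₀ ?_ fun v => (hpos v).ne') m
    exact (continuous_norm.pow 2).max continuous_const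
  have hle : ∀ v : E3, ‖((((max (‖v‖ ^ 2) (ρ ^ 2))⁻¹) ^ m : ℝ) : ℂ)‖ ≤ 64 * (1 + ‖v‖) ^ (-(6 : ℝ)) := by
    intro v
    set M : ℝ := max (‖v‖ ^ 2) (ρ ^ 2) with hM
    have hM1 : 1 ≤ M := le_trans (by nlinarith) (le_max_right _ _)
    have hMpos : 0 < M := by linarith
    rw [Complex.norm_real, Real.norm_eq_abs, abs_of_nonneg (by positivity)]
    -- `(M⁻¹)^m ≤ (M⁻¹)^3 ≤ 64 (1+‖v‖)^{-6}`
    have h1 : (M⁻¹) ^ m ≤ (M⁻¹) ^ 3 :=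
      pow_le_pow_of_le_one (by positivity) (inv_le_one_of_one_le₀ hM1) hm
    have h2 : (1 + ‖v‖) ^ 2 ≤ 4 * M := by
      have : ‖v‖ ^ 2 ≤ M := le_max_left _ _
      nlinarith [norm_nonneg v]
    have h3 : (1 + ‖v‖) ^ 6 ≤ 64 * M ^ 3 := by
      have := pow_le_pow_left₀ (by positivity) h2 3
      nlinarith [this]
    have h4 : (M⁻¹) ^ 3 ≤ 64 * (1 + ‖v‖) ^ (-(6 : ℝ)) := by
      rw [Real.rpow_neg (by positivity), show (6 : ℝ) = ((6 : ℕ) : ℝ) by norm_num, Real.rpow_natCast,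
        inv_pow, ← div_eq_mul_inv, le_div_iff₀ (by positivity)]
      calc (M ^ 3)⁻¹ * (1 + ‖v‖) ^ 6 ≤ (M ^ 3)⁻¹ * (64 * M ^ 3) := by gcongr
        _ = 64 := by field_simp
    exact h1.trans h4
  refine (((integrable_one_add_norm (E := E3) (μ := volume) (r := 6) ?_).const_mul 64)).mono'
    hcont.aestronglyMeasurable (ae_of_all _ hle)
  rw [finrank_euclideanSpace_fin]; norm_num

/-- **Composition: the landed assembly closes `FarSlackActive`** (statement = definiens verbatim). -/
theorem FarSlackActive_of : FarSlackActive := stub_farEqualAssembly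

end Summit.AtomisticToContinuum.Crystallization.Cruxes.ExactCertificate.FarEqual

end
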